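import Summits.BirchSwinnertonDyer.BirchSwinnertonDyer.Theorems.EisensteinPrimesUnramifiedInflation
import Summits.BirchSwinnertonDyer.BirchSwinnertonDyer.Theorems.EisensteinPrimesH2Bookkeeping
import HarnessLib

/-!
# The `H²` bookkeeping `hH2` of the V21 mid-level composition, in the LEAD's `unramifiedOutside`-currency, from weak Leopoldt
# and `cd_p ≤ 2` (cell `bsd-eis`, seat `bsd-line-x1-p1-w4` gen 4; crux 2 `GoodLatticeBDPValue` stmt-BirchSwinnertonDyer-19032,
# line `halves`, V21 road S4 — assembly file (C))

HONEST FRAMING (cell `bsd-eis`, run/shared/lean/pub/bsd-eis/): Galois-cohomology bookkeeping (no definition, no named fact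
INTRODUCED — the typed PUB fact `GaloisCohomology.groupCdLE_two_galoisGroupUnramifiedOutside K` (Harari Cor. 17.14 / NSW
(8.3.18)) is a HYPOTHESIS —, no `sorry`, no `Theses` import); nothing about any curve is asserted; BSD / IMC2 / KY Thm. 1.4.1
are proved for NO curve. Helper `--supports stmt-BirchSwinnertonDyer-19032`; closes no registered stub.

## What

`ResidualIndexAssembly.zpCorank_datumStrictSelmer_add_eq` (LEAD g4, p645893) takes as its last input the `H²` bookkeeping
`hH2 : #(U(N₃) ⧸ π_* U(N₂)) · #(U(A₂)/p) = #(U(A₁)/p) · #(U(A₃)/p)`, `U(M) = unramifiedOutside H M p S₀`. THIS FILE proves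
`hH2` (`natCard_H2bookkeeping_unramifiedOutside`, and `…_of_exists` with the descended representations of the `N_k` derived)
from: the residual exact sequence `0 → N₁ →i N₂ →π N₃ → 0` and the Kummer embeddings `j_k : N_k ↪ A_k` onto `A_k[p]` (`A_k`
`p`-divisible) exactly as in the LEAD's theorem; `H ⊴ Γ_K` CLOSED containing the ramification subgroup `N_Σ`, `Σ = S₀ ∪ {w ∣ p}`;
the modules DESCENDED to `G_{K,Σ}` (`ρ : ContinuousRep (GaloisGroupUnramifiedOutside K Σ) ℤ M`, `ρ(σ̄) m = σ • m`); **weak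
Leopoldt** `H²(Gal(K_Σ/L), A_k) = 0` (`Subsingleton (continuousCohomology 2 (ρA_k.restrict (galoisGroupAboveSubtype Σ H)).toTopRep)`,
three HYPOTHESES — w2 gen 4's lane); and `cd_p(G_{K,Σ}) ≤ 2` (the typed PUB fact, hypothesis; `p ≠ 2` if `K` has a real place).
Proof = file (A) `H2Bookkeeping.natCard_H2bookkeeping_of_groupCdLE` (p645763) over the compact group `Gal(K_Σ/L) =
galoisGroupAbove Σ H` + the inflation equivalences `H¹(Gal(K_Σ/L), M) ≃+ U(M)` of file (B2) (`UnramifiedInflation`, natural in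
`M`) + transport of `#coker` and `#(·/p)` along additive equivalences (§1).

References: [KellerYin2024] §1.4 (arXiv:2402.12781v2, proof of Thm. 1.4.1 (iii)); [SerreGaloisCohomology1997] I §2.2, §2.6, §3.3;
[NeukirchSchmidtWingberg2008] (8.3.18); [Harari2020] Cor. 17.14; the road memo `Cruxes/GoodLatticeBDPValue/Lines/halves-imprimLambda-index-road.md` §2 (6).
-/

set_option autoImplicit false
set_option linter.dupNamespace false -- the summit namespace `…BirchSwinnertonDyer.BirchSwinnertonDyer.Theorems` (Sub = Summit, D-0017) trips it

noncomputable section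

namespace Summit.BirchSwinnertonDyer.BirchSwinnertonDyer.Theorems.UnramifiedInflation

open CategoryTheory Function NumberField IsDedekindDomain Field Topology ContinuousCohomology
open Literature.NumberTheory.EllipticCurves Literature.NumberTheory.EllipticCurves.GreenbergSelmer
  Literature.NumberTheory.EllipticCurves.GreenbergVatsal2000 Literature.NumberTheory.GaloisRepresentations
  Literature.NumberTheory.IwasawaTheory.Greenberg2006
  Summit.BirchSwinnertonDyer.BirchSwinnertonDyer.Theorems.H2Bookkeeping

/-! ## §1 Transport of `#(X/pX)` and `#coker` along additive equivalences -/

section Transport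

/-- `#(X/pX) = #(Y/pY)` for `X ≃+ Y`. [folklore] -/
theorem natCard_modN_congr {X Y : Type*} [AddCommGroup X] [AddCommGroup Y] (e : X ≃+ Y) (p : ℕ) :
    Nat.card (ModN X p) = Nat.card (ModN Y p) := by
  have h : ((LinearMap.range (LinearMap.lsmul ℤ X p)).toAddSubgroup).map (e : X →+ Y) =
      (LinearMap.range (LinearMap.lsmul ℤ Y p)).toAddSubgroup := by
    ext y
    simp only [AddSubgroup.mem_map, Submodule.mem_toAddSubgroup, LinearMap.mem_range, LinearMap.lsmul_apply]
    constructor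
    · rintro ⟨x, ⟨b, rfl⟩, rfl⟩
      exact ⟨e b, by rw [AddMonoidHom.coe_coe, map_zsmul]⟩
    · rintro ⟨c, rfl⟩
      exact ⟨(p : ℤ) • e.symm c, ⟨e.symm c, rfl⟩, by rw [AddMonoidHom.coe_coe, map_zsmul, e.apply_symm_apply]⟩
  exact Nat.card_congr (QuotientAddGroup.congr _ _ e h).toEquiv

/-- `#(X₃ ⧸ im b) = #(Y ⧸ T)` when `e : X₃ ≃+ Y` carries `im b` onto `T`. [folklore] -/
theorem natCard_quotient_range_congr {X₂ X₃ Y : Type*} [AddCommGroup X₂] [AddCommGroup X₃] [AddCommGroup Y]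
    (b : X₂ →+ X₃) (e : X₃ ≃+ Y) (T : AddSubgroup Y) (hT : ∀ y, y ∈ T ↔ ∃ x : X₂, e (b x) = y) :
    Nat.card (X₃ ⧸ b.range) = Nat.card (Y ⧸ T) := by
  have h : b.range.map (e : X₃ →+ Y) = T := by
    ext y
    rw [hT, AddSubgroup.mem_map]
    constructor
    · rintro ⟨x, ⟨x₂, rfl⟩, rfl⟩
      exact ⟨x₂, rfl⟩
    · rintro ⟨x₂, rfl⟩
      exact ⟨b x₂, ⟨x₂, rfl⟩, rfl⟩
  exact Nat.card_congr (QuotientAddGroup.congr _ _ e h).toEquiv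

end Transport

/-! ## §2 The `H²` bookkeeping in the `unramifiedOutside` currency -/

section Main

variable {K : Type} [Field K] [NumberField K]
variable (H : Subgroup (absoluteGaloisGroup K)) [H.Normal] (p : ℕ) [Fact p.Prime] (S₀ : Set (HeightOneSpectrum (𝓞 K)))
variable {N₁ : Type} [AddCommGroup N₁] [DistribMulAction (absoluteGaloisGroup K) N₁] [TopologicalSpace N₁] [DiscreteTopology N₁]
variable {N₂ : Type} [AddCommGroup N₂] [DistribMulAction (absoluteGaloisGroup K) N₂] [TopologicalSpace N₂] [DiscreteTopology N₂]
variable {N₃ : Type} [AddCommGroup N₃] [DistribMulAction (absoluteGaloisGroup K) N₃] [TopologicalSpace N₃] [DiscreteTopology N₃]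
variable {A₁ : Type} [AddCommGroup A₁] [DistribMulAction (absoluteGaloisGroup K) A₁] [TopologicalSpace A₁] [DiscreteTopology A₁]
variable {A₂ : Type} [AddCommGroup A₂] [DistribMulAction (absoluteGaloisGroup K) A₂] [TopologicalSpace A₂] [DiscreteTopology A₂]
variable {A₃ : Type} [AddCommGroup A₃] [DistribMulAction (absoluteGaloisGroup K) A₃] [TopologicalSpace A₃] [DiscreteTopology A₃]

/-- **The `H²` bookkeeping of the V21 road in the `unramifiedOutside` currency (all six modules descended).** For `H ⊴ Γ_K`
closed with `N_Σ ≤ H` (`Σ = S₀ ∪ {w ∣ p}`), a residual exact sequence `0 → N₁ →i N₂ →π N₃ → 0`, Kummer embeddings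
`j_k : N_k ↪ A_k` onto `A_k[p]` with `A_k` `p`-divisible, all six modules descended to `G_{K,Σ}`, weak Leopoldt
`H²(Gal(K_Σ/L), A_k) = 0` (`k = 1, 2, 3`) and `cd_p(G_{K,Σ}) ≤ 2` (typed fact, hypothesis):
`#(U(N₃) ⧸ π_* U(N₂)) · #(U(A₂)/p) = #(U(A₁)/p) · #(U(A₃)/p)` — the hypothesis `hH2` of
`ResidualIndexAssembly.zpCorank_datumStrictSelmer_add_eq`, verbatim. [cite: KellerYin2024, §1.4 (proof of Thm. 1.4.1 (iii))]
[cite: SerreGaloisCohomology1997, I §2.2 and §2.6 (b)] [cite: Harari2020, Cor. 17.14 (p. 295)] -/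
theorem natCard_H2bookkeeping_unramifiedOutside (hH : IsClosed (H : Set (absoluteGaloisGroup K)))
    (hNH : ramificationSubgroup K (S₀ ∪ {v | ((p : ℕ) : 𝓞 K) ∈ v.asIdeal}) ≤ H)
    -- the residual exact sequence `0 → N₁ → N₂ → N₃ → 0`
    (i : N₁ →+ N₂) (π : N₂ →+ N₃)
    (hi : ∀ (g : absoluteGaloisGroup K) (a : N₁), i (g • a) = g • i a)
    (hπ : ∀ (g : absoluteGaloisGroup K) (b : N₂), π (g • b) = g • π b)
    (hiinj : Injective i) (hπsurj : Surjective π) (hexact : ∀ b : N₂, π b = 0 → ∃ a : N₁, i a = b)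
    (hπi : ∀ a : N₁, π (i a) = 0)
    -- the Kummer embeddings `j_k : N_k ↪ A_k` onto `A_k[p]`, `A_k` divisible
    (j₁ : N₁ →+ A₁) (j₂ : N₂ →+ A₂) (j₃ : N₃ →+ A₃)
    (hj₁ : ∀ (g : absoluteGaloisGroup K) (a : N₁), j₁ (g • a) = g • j₁ a)
    (hj₂ : ∀ (g : absoluteGaloisGroup K) (a : N₂), j₂ (g • a) = g • j₂ a)
    (hj₃ : ∀ (g : absoluteGaloisGroup K) (a : N₃), j₃ (g • a) = g • j₃ a)
    (hj₁inj : Injective j₁) (hj₂inj : Injective j₂) (hj₃inj : Injective j₃)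
    (hr₁ : ∀ x : A₁, x ∈ j₁.range ↔ p • x = 0) (hr₂ : ∀ x : A₂, x ∈ j₂.range ↔ p • x = 0)
    (hr₃ : ∀ x : A₃, x ∈ j₃.range ↔ p • x = 0)
    (hd₁ : ∀ x : A₁, ∃ x' : A₁, p • x' = x) (hd₂ : ∀ x : A₂, ∃ x' : A₂, p • x' = x)
    (hd₃ : ∀ x : A₃, ∃ x' : A₃, p • x' = x)
    -- the six modules descended to `G_{K,Σ}`
    (ρN₁ : ContinuousRep (GaloisGroupUnramifiedOutside K (S₀ ∪ {v | ((p : ℕ) : 𝓞 K) ∈ v.asIdeal})) ℤ N₁)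
    (ρN₂ : ContinuousRep (GaloisGroupUnramifiedOutside K (S₀ ∪ {v | ((p : ℕ) : 𝓞 K) ∈ v.asIdeal})) ℤ N₂)
    (ρN₃ : ContinuousRep (GaloisGroupUnramifiedOutside K (S₀ ∪ {v | ((p : ℕ) : 𝓞 K) ∈ v.asIdeal})) ℤ N₃)
    (ρA₁ : ContinuousRep (GaloisGroupUnramifiedOutside K (S₀ ∪ {v | ((p : ℕ) : 𝓞 K) ∈ v.asIdeal})) ℤ A₁)
    (ρA₂ : ContinuousRep (GaloisGroupUnramifiedOutside K (S₀ ∪ {v | ((p : ℕ) : 𝓞 K) ∈ v.asIdeal})) ℤ A₂)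
    (ρA₃ : ContinuousRep (GaloisGroupUnramifiedOutside K (S₀ ∪ {v | ((p : ℕ) : 𝓞 K) ∈ v.asIdeal})) ℤ A₃)
    (hρN₁ : ∀ (σ : absoluteGaloisGroup K) (m : N₁), ρN₁ (toUnramifiedQuot K _ σ) m = σ • m)
    (hρN₂ : ∀ (σ : absoluteGaloisGroup K) (m : N₂), ρN₂ (toUnramifiedQuot K _ σ) m = σ • m)
    (hρN₃ : ∀ (σ : absoluteGaloisGroup K) (m : N₃), ρN₃ (toUnramifiedQuot K _ σ) m = σ • m)
    (hρA₁ : ∀ (σ : absoluteGaloisGroup K) (m : A₁), ρA₁ (toUnramifiedQuot K _ σ) m = σ • m)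
    (hρA₂ : ∀ (σ : absoluteGaloisGroup K) (m : A₂), ρA₂ (toUnramifiedQuot K _ σ) m = σ • m)
    (hρA₃ : ∀ (σ : absoluteGaloisGroup K) (m : A₃), ρA₃ (toUnramifiedQuot K _ σ) m = σ • m)
    -- weak Leopoldt over `L = K̄^H`
    [Subsingleton (continuousCohomology 2 (ρA₁.restrict (galoisGroupAboveSubtype _ H)).toTopRep)]
    [Subsingleton (continuousCohomology 2 (ρA₂.restrict (galoisGroupAboveSubtype _ H)).toTopRep)]
    [Subsingleton (continuousCohomology 2 (ρA₃.restrict (galoisGroupAboveSubtype _ H)).toTopRep)]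
    -- `cd_p(G_{K,Σ}) ≤ 2`
    (hcd : Literature.NumberTheory.GaloisCohomology.groupCdLE_two_galoisGroupUnramifiedOutside K)
    (hreal : (∃ w : InfinitePlace K, w.IsReal) → p ≠ 2) :
    Nat.card (↥(unramifiedOutside H N₃ p S₀) ⧸
        ((unramifiedOutside H N₂ p S₀).map (resH1Hom (ContinuousMonoidHom.id H) π
          (fun g b ↦ hπ (g : absoluteGaloisGroup K) b))).addSubgroupOf (unramifiedOutside H N₃ p S₀)) *
        Nat.card (ModN (unramifiedOutside H A₂ p S₀) p) =
      Nat.card (ModN (unramifiedOutside H A₁ p S₀) p) * Nat.card (ModN (unramifiedOutside H A₃ p S₀) p) := by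
  -- the compact group `𝔊 = Gal(K_Σ/L)`
  haveI : CompactSpace (galoisGroupAbove (S₀ ∪ {v | ((p : ℕ) : 𝓞 K) ∈ v.asIdeal}) H) := compactSpace_galoisGroupAbove _ H hH
  haveI : LocallyCompactSpace (galoisGroupAbove (S₀ ∪ {v | ((p : ℕ) : 𝓞 K) ∈ v.asIdeal}) H) :=
    (isClosed_galoisGroupAbove _ H hH).isClosedEmbedding_subtypeVal.locallyCompactSpace
  have hpS : ∀ v : HeightOneSpectrum (𝓞 K), ((p : ℕ) : 𝓞 K) ∈ v.asIdeal → v ∈ S₀ ∪ {v | ((p : ℕ) : 𝓞 K) ∈ v.asIdeal} :=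
    fun v hv ↦ Or.inr hv
  have hcdG := groupCdLE_two_galoisGroupAbove _ H hH hcd p hpS hreal
  -- the morphisms over `𝔊`
  obtain ⟨I, hI⟩ := exists_hom_restrict _ H ρN₁ ρN₂ hρN₁ hρN₂ i hi
  obtain ⟨P, hP⟩ := exists_hom_restrict _ H ρN₂ ρN₃ hρN₂ hρN₃ π hπ
  obtain ⟨J₁, hJ₁⟩ := exists_hom_restrict _ H ρN₁ ρA₁ hρN₁ hρA₁ j₁ hj₁
  obtain ⟨J₂, hJ₂⟩ := exists_hom_restrict _ H ρN₂ ρA₂ hρN₂ hρA₂ j₂ hj₂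
  obtain ⟨J₃, hJ₃⟩ := exists_hom_restrict _ H ρN₃ ρA₃ hρN₃ hρA₃ j₃ hj₃
  have hSES : IsSES I P :=
    { comp_eq_zero := by
        ext a
        change P.hom (I.hom a) = 0
        rw [hI, hP]; exact hπi a
      injective := fun a b h ↦ hiinj (by rw [← hI, ← hI]; exact h)
      exact_mid := fun y hy ↦ by
        rw [hP] at hy
        obtain ⟨a, ha⟩ := hexact y hy
        exact ⟨a, by rw [hI, ha]⟩
      surjective := fun c ↦ by
        obtain ⟨b, hb⟩ := hπsurj c
        exact ⟨b, by rw [hP, hb]⟩ }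
  have hpN₁ : ∀ n : N₁, p • n = 0 := fun n ↦ hj₁inj (by rw [map_nsmul, map_zero]; exact (hr₁ _).1 ⟨n, rfl⟩)
  -- file (A) over `𝔊`
  have key := natCard_H2bookkeeping_of_groupCdLE hSES hcdG hpN₁ J₁ J₂ J₃
    (fun a b h ↦ hj₁inj (by rw [← hJ₁, ← hJ₁]; exact h)) (fun n ↦ by rw [hJ₁]; exact (hr₁ _).1 ⟨n, rfl⟩)
    (fun m hm ↦ by obtain ⟨n, hn⟩ := (hr₁ m).2 hm; exact ⟨n, by rw [hJ₁, hn]⟩) hd₁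
    (fun a b h ↦ hj₂inj (by rw [← hJ₂, ← hJ₂]; exact h)) (fun n ↦ by rw [hJ₂]; exact (hr₂ _).1 ⟨n, rfl⟩)
    (fun m hm ↦ by obtain ⟨n, hn⟩ := (hr₂ m).2 hm; exact ⟨n, by rw [hJ₂, hn]⟩) hd₂
    (fun a b h ↦ hj₃inj (by rw [← hJ₃, ← hJ₃]; exact h)) (fun n ↦ by rw [hJ₃]; exact (hr₃ _).1 ⟨n, rfl⟩)
    (fun m hm ↦ by obtain ⟨n, hn⟩ := (hr₃ m).2 hm; exact ⟨n, by rw [hJ₃, hn]⟩) hd₃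
  -- the inflation equivalences
  obtain ⟨e₂, he₂⟩ := exists_addEquiv_unramifiedOutside H p S₀ ρN₂ hH hNH hρN₂
  obtain ⟨e₃, he₃⟩ := exists_addEquiv_unramifiedOutside H p S₀ ρN₃ hH hNH hρN₃
  obtain ⟨f₁, -⟩ := exists_addEquiv_unramifiedOutside H p S₀ ρA₁ hH hNH hρA₁
  obtain ⟨f₂, -⟩ := exists_addEquiv_unramifiedOutside H p S₀ ρA₂ hH hNH hρA₂
  obtain ⟨f₃, -⟩ := exists_addEquiv_unramifiedOutside H p S₀ ρA₃ hH hNH hρA₃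
  -- naturality of inflation along `π`
  have hnat : ∀ x : continuousCohomology 1 (ρN₂.restrict (galoisGroupAboveSubtype _ H)).toTopRep,
      ((e₃ (cohomologyMap P 1 x) : unramifiedOutside H N₃ p S₀) : subgroupH1 H N₃) =
        resH1Hom (ContinuousMonoidHom.id H) π (fun g b ↦ hπ (g : absoluteGaloisGroup K) b)
          ((e₂ x : unramifiedOutside H N₂ p S₀) : subgroupH1 H N₂) := by
    intro x
    have h := inflation_natural hρN₂ ((unramifiedOutside H N₂ p S₀).subtype.comp e₂.toAddMonoidHom)
      (fun φ ψ hψ ↦ he₂ φ ψ hψ) ((unramifiedOutside H N₃ p S₀).subtype.comp e₃.toAddMonoidHom)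
      (fun φ ψ hψ ↦ he₃ φ ψ hψ) π hπ P hP x
    exact h
  rw [natCard_modN_congr f₁ p, natCard_modN_congr f₂ p, natCard_modN_congr f₃ p] at key
  rw [← natCard_quotient_range_congr (cohomologyMap P 1).hom.toLinearMap.toAddMonoidHom e₃ _ (fun y ↦ ?_)]
  · exact key
  -- membership in `π_* U(N₂)` pulled back to `U(N₃)`
  rw [AddSubgroup.mem_addSubgroupOf, AddSubgroup.mem_map]
  constructor
  · rintro ⟨u, hu, hy⟩
    obtain ⟨x, hx⟩ := e₂.surjective ⟨u, hu⟩
    refine ⟨x, Subtype.ext ?_⟩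
    rw [← hy]
    have h := hnat x
    rw [hx] at h
    exact h
  · rintro ⟨x, rfl⟩
    exact ⟨(e₂ x : unramifiedOutside H N₂ p S₀), (e₂ x).2, (hnat x).symm⟩

/-- **The `H²` bookkeeping, with the descended representations of `N₁, N₂, N₃` derived** from the continuity of the `Γ_K`-orbits
(the `N_Σ`-triviality being inherited from `A_k` along `j_k`): only the three modules `A_k` carrying the weak-Leopoldt
hypotheses need to be given as representations of `G_{K,Σ}`. [cite: KellerYin2024, §1.4 (proof of Thm. 1.4.1 (iii))]
[cite: SerreGaloisCohomology1997, I §2.2 and §2.6 (b)] [cite: Harari2020, Cor. 17.14 (p. 295)] -/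
theorem natCard_H2bookkeeping_unramifiedOutside_of_continuous (hH : IsClosed (H : Set (absoluteGaloisGroup K)))
    (hNH : ramificationSubgroup K (S₀ ∪ {v | ((p : ℕ) : 𝓞 K) ∈ v.asIdeal}) ≤ H)
    (i : N₁ →+ N₂) (π : N₂ →+ N₃)
    (hi : ∀ (g : absoluteGaloisGroup K) (a : N₁), i (g • a) = g • i a)
    (hπ : ∀ (g : absoluteGaloisGroup K) (b : N₂), π (g • b) = g • π b)
    (hiinj : Injective i) (hπsurj : Surjective π) (hexact : ∀ b : N₂, π b = 0 → ∃ a : N₁, i a = b)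
    (hπi : ∀ a : N₁, π (i a) = 0)
    (j₁ : N₁ →+ A₁) (j₂ : N₂ →+ A₂) (j₃ : N₃ →+ A₃)
    (hj₁ : ∀ (g : absoluteGaloisGroup K) (a : N₁), j₁ (g • a) = g • j₁ a)
    (hj₂ : ∀ (g : absoluteGaloisGroup K) (a : N₂), j₂ (g • a) = g • j₂ a)
    (hj₃ : ∀ (g : absoluteGaloisGroup K) (a : N₃), j₃ (g • a) = g • j₃ a)
    (hj₁inj : Injective j₁) (hj₂inj : Injective j₂) (hj₃inj : Injective j₃)
    (hr₁ : ∀ x : A₁, x ∈ j₁.range ↔ p • x = 0) (hr₂ : ∀ x : A₂, x ∈ j₂.range ↔ p • x = 0)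
    (hr₃ : ∀ x : A₃, x ∈ j₃.range ↔ p • x = 0)
    (hd₁ : ∀ x : A₁, ∃ x' : A₁, p • x' = x) (hd₂ : ∀ x : A₂, ∃ x' : A₂, p • x' = x)
    (hd₃ : ∀ x : A₃, ∃ x' : A₃, p • x' = x)
    -- continuity of the orbit maps of the residual modules
    (hcN₁ : ∀ a : N₁, Continuous fun g : absoluteGaloisGroup K ↦ g • a)
    (hcN₂ : ∀ a : N₂, Continuous fun g : absoluteGaloisGroup K ↦ g • a)
    (hcN₃ : ∀ a : N₃, Continuous fun g : absoluteGaloisGroup K ↦ g • a)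
    -- the modules `A_k` descended to `G_{K,Σ}`, with weak Leopoldt over `L = K̄^H`
    (ρA₁ : ContinuousRep (GaloisGroupUnramifiedOutside K (S₀ ∪ {v | ((p : ℕ) : 𝓞 K) ∈ v.asIdeal})) ℤ A₁)
    (ρA₂ : ContinuousRep (GaloisGroupUnramifiedOutside K (S₀ ∪ {v | ((p : ℕ) : 𝓞 K) ∈ v.asIdeal})) ℤ A₂)
    (ρA₃ : ContinuousRep (GaloisGroupUnramifiedOutside K (S₀ ∪ {v | ((p : ℕ) : 𝓞 K) ∈ v.asIdeal})) ℤ A₃)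
    (hρA₁ : ∀ (σ : absoluteGaloisGroup K) (m : A₁), ρA₁ (toUnramifiedQuot K _ σ) m = σ • m)
    (hρA₂ : ∀ (σ : absoluteGaloisGroup K) (m : A₂), ρA₂ (toUnramifiedQuot K _ σ) m = σ • m)
    (hρA₃ : ∀ (σ : absoluteGaloisGroup K) (m : A₃), ρA₃ (toUnramifiedQuot K _ σ) m = σ • m)
    [Subsingleton (continuousCohomology 2 (ρA₁.restrict (galoisGroupAboveSubtype _ H)).toTopRep)]
    [Subsingleton (continuousCohomology 2 (ρA₂.restrict (galoisGroupAboveSubtype _ H)).toTopRep)]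
    [Subsingleton (continuousCohomology 2 (ρA₃.restrict (galoisGroupAboveSubtype _ H)).toTopRep)]
    (hcd : Literature.NumberTheory.GaloisCohomology.groupCdLE_two_galoisGroupUnramifiedOutside K)
    (hreal : (∃ w : InfinitePlace K, w.IsReal) → p ≠ 2) :
    Nat.card (↥(unramifiedOutside H N₃ p S₀) ⧸
        ((unramifiedOutside H N₂ p S₀).map (resH1Hom (ContinuousMonoidHom.id H) π
          (fun g b ↦ hπ (g : absoluteGaloisGroup K) b))).addSubgroupOf (unramifiedOutside H N₃ p S₀)) *
        Nat.card (ModN (unramifiedOutside H A₂ p S₀) p) =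
      Nat.card (ModN (unramifiedOutside H A₁ p S₀) p) * Nat.card (ModN (unramifiedOutside H A₃ p S₀) p) := by
  -- `N_Σ` acts trivially on `A_k` (descended), hence on `N_k` (embedded)
  have htA : ∀ {A : Type} [AddCommGroup A] [DistribMulAction (absoluteGaloisGroup K) A] [TopologicalSpace A]
      (ρ : ContinuousRep (GaloisGroupUnramifiedOutside K (S₀ ∪ {v | ((p : ℕ) : 𝓞 K) ∈ v.asIdeal})) ℤ A),
      (∀ (σ : absoluteGaloisGroup K) (m : A), ρ (toUnramifiedQuot K _ σ) m = σ • m) →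
      ∀ σ ∈ ramificationSubgroup K (S₀ ∪ {v | ((p : ℕ) : 𝓞 K) ∈ v.asIdeal}), ∀ m : A, σ • m = m := by
    intro A _ _ _ ρ hρ σ hσ m
    have h1 : toUnramifiedQuot K (S₀ ∪ {v | ((p : ℕ) : 𝓞 K) ∈ v.asIdeal}) σ = 1 := (QuotientGroup.eq_one_iff σ).mpr hσ
    rw [← hρ, h1, map_one]
    rfl
  have htN : ∀ {N A : Type} [AddCommGroup N] [DistribMulAction (absoluteGaloisGroup K) N] [AddCommGroup A]
      [DistribMulAction (absoluteGaloisGroup K) A] (j : N →+ A), (∀ (g : absoluteGaloisGroup K) (a : N), j (g • a) = g • j a) →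
      Injective j → (∀ σ ∈ ramificationSubgroup K (S₀ ∪ {v | ((p : ℕ) : 𝓞 K) ∈ v.asIdeal}), ∀ m : A, σ • m = m) →
      ∀ σ ∈ ramificationSubgroup K (S₀ ∪ {v | ((p : ℕ) : 𝓞 K) ∈ v.asIdeal}), ∀ n : N, σ • n = n := by
    intro N A _ _ _ _ j hj hjinj ht σ hσ n
    exact hjinj (by rw [hj, ht σ hσ])
  obtain ⟨ρN₁, hρN₁⟩ := exists_continuousRep_quot _ hcN₁ (htN j₁ hj₁ hj₁inj (htA ρA₁ hρA₁))
  obtain ⟨ρN₂, hρN₂⟩ := exists_continuousRep_quot _ hcN₂ (htN j₂ hj₂ hj₂inj (htA ρA₂ hρA₂))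
  obtain ⟨ρN₃, hρN₃⟩ := exists_continuousRep_quot _ hcN₃ (htN j₃ hj₃ hj₃inj (htA ρA₃ hρA₃))
  exact natCard_H2bookkeeping_unramifiedOutside H p S₀ hH hNH i π hi hπ hiinj hπsurj hexact hπi j₁ j₂ j₃ hj₁ hj₂ hj₃
    hj₁inj hj₂inj hj₃inj hr₁ hr₂ hr₃ hd₁ hd₂ hd₃ ρN₁ ρN₂ ρN₃ ρA₁ ρA₂ ρA₃ hρN₁ hρN₂ hρN₃ hρA₁ hρA₂ hρA₃ hcd hreal

end Main

end Summit.BirchSwinnertonDyer.BirchSwinnertonDyer.Theorems.UnramifiedInflation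

end
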